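import Mathlib

/-!
# Chen 2024, Step 9 (§3.5.9): the domain-extension equation is false — a kernel-checked verdict

REPRODUCTION / ANALYSIS OF A CLAIMED RESULT UNDER ADJUDICATION (withdrawn): Yilei Chen, *Quantum
Algorithms for Lattice Problems*, IACR ePrint 2024/555, version of 2024-04-18 [ChenQuantumLattice2024];
the author's withdrawal notes are quoted below and in `ChenQuantumLWESteps.lean`.  Bundle
`papers/QuantumAdvantage/lwe-quantum-autopsy/`: this module was AUTHORED by Part 4 (unit b2b-lwe-4, seat
referee-b2b-lwe-4-0) as the package module `LweAutopsy/StepNine.lean` and is filed in the tree verbatim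
(namespace moved, provenance tags added) by Part 1 under the in-tree rule.  HONEST FRAMING: a
kernel-checked VERDICT (support count) about one displayed equation of a WITHDRAWN algorithm — a precise
negative result, NOT summit progress, no cryptanalytic claim in either direction.  It is self-contained
(its own two-register model `Params`); the full `(n+1)`-register objects are `Chen2024.Shape.phi8f`,
`Shape.phi8gDisplayed`, `Shape.Step9Display` of `ChenQuantumLWESteps.lean`, and the sharper product-state
diagnosis is `ChenQuantumLWEProductProofs.lean`.

Y. Chen, *Quantum Algorithms for Lattice Problems*, Cryptology ePrint Archive 2024/555, version of
April 18, 2024 (the version carrying the author's inline notes).  Step 9 of the algorithm (§3.5.9,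
proof of Lemma 3.8) starts from the state, eq. (40),

  |φ8.f⟩ = Σ_{j∈ℤ} e^{-2πi (2Dj)²/(2M)} | 2D²·j·b* + (0 | v*)  mod M/2 ⟩,   M/2 = D²·p₁p₂⋯p_κ,

whose first coordinate is `2D²·j·b*₁ mod D²p₁⋯p_κ` with `b*₁ = p₂⋯p_κ` (so it depends on `j` only
through `j mod p₁`), while the remaining coordinates `2D²·j·b*_η + v*_η mod D²p₁⋯p_κ`, `b*_η ∈ 2p₁ℤ`,
depend on `j` through `j mod p₂⋯p_κ`.  The paper then "appl[ies] the domain extension trick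
(Lemma 2.17) on the first coordinate of |φ8.f⟩ to extend the domain of the first coordinate from
D²p₁p₂⋯p_κ to D²p₁p₂⋯p_κ·p₂⋯p_κ" and DISPLAYS the result as

  |φ8.g⟩ = Σ_{j∈ℤ} e^{-2πi (2Dj)²/(2M)} | 2D²·j·b*₁  mod D²p₁⋯p_κ·p₂⋯p_κ ⟩ | 2D²·j·b*_rest + v*_rest mod D²p₁⋯p_κ ⟩,

i.e. with the lifted first coordinate STILL driven by the same summation index `j` as the other
coordinates.  Lemma 2.17, however, lifts the first coordinate of every basis vector of the input
uniformly: `|x₁⟩ ↦ Σ_{h ∈ ℤ_C} |x₁ + h·(D²p₁⋯p_κ)⟩`, independently of the other coordinates.  The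
author's note of April 18 (ibid., after the display of |φ8.g⟩): "the support of |φ8.f⟩ contains
p₁⋯p_κ vectors.  After domain extension, we should have got p₁p₂⋯p_κ · p₂⋯p_κ vectors, but as the way
|φ8.g⟩ is written, it only contains p₁⋯p_κ vectors.  So the expression of |φ8.g⟩ is wrong."

This file makes that sentence a kernel-checked statement.  Every amplitude in (40) is a root of unity,
hence non-zero, so the SUPPORT of each state is a combinatorial object independent of the phases:

* `claimedSupport` = the support of the displayed |φ8.g⟩ (a function of `j` alone);
* `extendedSupport` = the support of what Lemma 2.17 actually produces from |φ8.f⟩ (a function of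
  `(j, h)` with `h` the independent lift index).

The general theorem `card_extendedSupport` / `card_claimedSupport` gives `|extendedSupport| = P·Q`
and `|claimedSupport| = P` with `P = p₁·Q`, `Q = p₂⋯p_κ`, for EVERY choice of the parameters in
Chen's range (`Admissible`: `D ≥ 1`, `p₁, Q` odd and coprime, `Q ≥ 3`, `gcd(c, Q) = 1`); `claimedSupport_ne_extendedSupport` is the
verdict: the two states have different supports, so the displayed equation |φ8.g⟩ = DomainExt(|φ8.f⟩)
is false.  Two concrete instances (`p₁ = 3, Q = 5` and `p₁ = 5, Q = 3`, `D = 1`) are additionally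
checked by `decide` with no hypotheses at all.

Conventions.  `N := D²·p₁·Q` is the modulus `M/2` of the registers; the model keeps the first
coordinate and ONE representative of the remaining coordinates, with coefficient `2p₁·c`, `gcd(c, Q) = 1`
(Chen: `b*_η ∈ 2p₁ℤ`, with the `p₂, …, p_κ` slots of the other coordinates filled so that their period in
`j` is exactly `Q`; eq. (39)).  The constant shift `v*` is dropped (a translation does not change
cardinalities).  All statements are about supports in `ZMod (N·Q) × ZMod N`.
-/

namespace Literature.Computability.Cryptography.Chen2024.StepNine

/-- Parameters of Step 9: `D`, `p₁`, `Q = p₂⋯p_κ`, and the coefficient `c` of the representative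
remaining coordinate (`b*_rest = 2p₁·c`). [cite: ChenQuantumLattice2024, Cond. C.3 p. 18 and eq. (39) p. 36] -/
structure Params where
  /-- the scaling factor `D` -/
  D : ℕ
  /-- the first planted prime -/
  p₁ : ℕ
  /-- `Q = p₂⋯p_κ` -/
  Q : ℕ
  /-- coefficient of the representative remaining coordinate, `b*_rest = 2p₁c` -/
  c : ℕ

namespace Params

variable (π : Params)

/-- `P = p₁·Q = p₁p₂⋯p_κ`, the period of `j`. [cite: ChenQuantumLattice2024, Cond. C.3 p. 18] -/
def P : ℕ := π.p₁ * π.Q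

/-- `N = D²·P = M/2`, the register modulus. [cite: ChenQuantumLattice2024, Cond. C.3 p. 18] -/
def N : ℕ := π.D ^ 2 * π.P

/-- Chen's admissible range: `D ≥ 1`, `p₁`, `Q` odd, coprime, `Q ≥ 3` (so κ ≥ 2), and the
representative coefficient `c` coprime to `Q`. [cite: ChenQuantumLattice2024, Cond. C.3 p. 18 and eq. (39) p. 36] -/
structure Admissible : Prop where
  /-- `D ≥ 1` -/
  D_pos : 0 < π.D
  /-- `p₁` odd -/
  p₁_odd : Odd π.p₁
  /-- `Q` odd -/
  Q_odd : Odd π.Q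
  /-- `p₁ ≥ 1` -/
  p₁_pos : 0 < π.p₁
  /-- `Q ≥ 3` (`κ ≥ 2`) -/
  Q_ge : 3 ≤ π.Q
  /-- `gcd(p₁, Q) = 1` -/
  coprime : Nat.Coprime π.p₁ π.Q
  /-- `gcd(c, Q) = 1` -/
  c_coprime : Nat.Coprime π.c π.Q

/-- The first coordinate of |φ8.f⟩ as a function of `j`: `2D²·j·Q mod N`. [cite: ChenQuantumLattice2024, eq. (40) p. 36] -/
def first (j : ℕ) : ZMod π.N := ((2 * π.D ^ 2 * π.Q * j : ℕ) : ZMod π.N)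

/-- The representative remaining coordinate: `2D²·j·(2p₁c) mod N`. [cite: ChenQuantumLattice2024, eq. (40) p. 36] -/
def rest (j : ℕ) : ZMod π.N := ((2 * π.D ^ 2 * (2 * π.p₁ * π.c) * j : ℕ) : ZMod π.N)

/-- The displayed |φ8.g⟩: first coordinate `2D²·j·Q mod N·Q`, same `j` in both registers. [cite: ChenQuantumLattice2024, §3.5.9 p. 37] -/
def claimed (j : ℕ) : ZMod (π.N * π.Q) × ZMod π.N :=
  (((2 * π.D ^ 2 * π.Q * j : ℕ) : ZMod (π.N * π.Q)), π.rest j)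

/-- What Lemma 2.17 produces from |φ8.f⟩: the first coordinate `first j` lifted by an INDEPENDENT
`h ∈ ℤ_Q`, i.e. `(first j).val + h·N mod N·Q`. [cite: ChenQuantumLattice2024, Lemma 2.17 p. 14 and §3.5.9 p. 37] -/
def extended (j h : ℕ) : ZMod (π.N * π.Q) × ZMod π.N :=
  ((((π.first j).val + h * π.N : ℕ) : ZMod (π.N * π.Q)), π.rest j)

/-- Support of the displayed |φ8.g⟩ (`j` ranges over a full period `N·Q` of both coordinates). [cite: ChenQuantumLattice2024, §3.5.9 p. 37] -/
def claimedSupport : Finset (ZMod (π.N * π.Q) × ZMod π.N) :=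
  (Finset.range (π.N * π.Q)).image π.claimed

/-- Support of `DomainExt(|φ8.f⟩)`: `j` over a period, `h` over `ℤ_Q`. [cite: ChenQuantumLattice2024, §3.5.9 p. 37] -/
def extendedSupport : Finset (ZMod (π.N * π.Q) × ZMod π.N) :=
  ((Finset.range π.N) ×ˢ (Finset.range π.Q)).image fun jh => π.extended jh.1 jh.2

end Params

/-! ### Two concrete instances, decided by the kernel -/

/-- `κ = 2`, `D = 1`, `p₁ = 3`, `p₂ = 5`: `P = 15`, `N = 15`, registers in `ZMod 75 × ZMod 15`. [cite: ChenQuantumLattice2024, §3.5.9 p. 37] -/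
def inst35 : Params := ⟨1, 3, 5, 1⟩

/-- `κ = 2`, `D = 1`, `p₁ = 5`, `p₂ = 3`: `P = 15`, `N = 15`, registers in `ZMod 45 × ZMod 15`. [cite: ChenQuantumLattice2024, §3.5.9 p. 37] -/
def inst53 : Params := ⟨1, 5, 3, 1⟩

/-- Instance (3,5): the displayed |φ8.g⟩ has 15 basis vectors (kernel-decided). [cite: ChenQuantumLattice2024, §3.5.9 p. 37] -/
theorem inst35_claimed_card : inst35.claimedSupport.card = 15 := by decide
/-- Instance (3,5): the honest domain extension has 75 basis vectors (kernel-decided). [cite: ChenQuantumLattice2024, §3.5.9 p. 37] -/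
theorem inst35_extended_card : inst35.extendedSupport.card = 75 := by decide
/-- Instance (3,5): the two supports differ (kernel-decided). [cite: ChenQuantumLattice2024, §3.5.9 p. 37] -/
theorem inst35_ne : inst35.claimedSupport ≠ inst35.extendedSupport := by decide

/-- Instance (5,3): the displayed |φ8.g⟩ has 15 basis vectors (kernel-decided). [cite: ChenQuantumLattice2024, §3.5.9 p. 37] -/
theorem inst53_claimed_card : inst53.claimedSupport.card = 15 := by decide
/-- Instance (5,3): the honest domain extension has 45 basis vectors (kernel-decided). [cite: ChenQuantumLattice2024, §3.5.9 p. 37] -/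
theorem inst53_extended_card : inst53.extendedSupport.card = 45 := by decide
/-- Instance (5,3): the two supports differ (kernel-decided). [cite: ChenQuantumLattice2024, §3.5.9 p. 37] -/
theorem inst53_ne : inst53.claimedSupport ≠ inst53.extendedSupport := by decide

/-! ### The general statement: every admissible parameter choice -/

namespace Params

variable (π : Params)

/-- `P > 0` for admissible parameters. [folklore] -/
theorem P_pos (h : π.Admissible) : 0 < π.P := Nat.mul_pos h.p₁_pos (by have := h.Q_ge; omega)

/-- `N > 0` for admissible parameters. [folklore] -/
theorem N_pos (h : π.Admissible) : 0 < π.N := Nat.mul_pos (pow_pos h.D_pos 2) (π.P_pos h)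

/-- `N·Q = (D²Q)·(p₁Q)`. [folklore] -/
theorem NQ_eq : π.N * π.Q = (π.D ^ 2 * π.Q) * (π.p₁ * π.Q) := by
  simp only [Params.N, Params.P]; ring

/-- `P` is odd for admissible parameters. [folklore] -/
theorem P_odd (h : π.Admissible) : Odd π.P := h.p₁_odd.mul h.Q_odd

/-- The first coordinate of the displayed |φ8.g⟩ determines `j mod P` and nothing more. [cite: ChenQuantumLattice2024, §3.5.9 p. 37] -/
theorem claimed_fst_eq_iff (h : π.Admissible) (j j' : ℕ) :
    ((2 * π.D ^ 2 * π.Q * j : ℕ) : ZMod (π.N * π.Q)) = ((2 * π.D ^ 2 * π.Q * j' : ℕ) : ZMod (π.N * π.Q))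
      ↔ j ≡ j' [MOD π.P] := by
  rw [ZMod.natCast_eq_natCast_iff, π.NQ_eq,
    show 2 * π.D ^ 2 * π.Q * j = (π.D ^ 2 * π.Q) * (2 * j) by ring,
    show 2 * π.D ^ 2 * π.Q * j' = (π.D ^ 2 * π.Q) * (2 * j') by ring,
    Nat.ModEq.mul_left_cancel_iff' (Nat.mul_pos (pow_pos h.D_pos 2) (by have := h.Q_ge; omega)).ne']
  have hcop : Nat.gcd (π.p₁ * π.Q) 2 = 1 := Nat.coprime_two_right.mpr (h.p₁_odd.mul h.Q_odd)
  exact ⟨fun e => Nat.ModEq.cancel_left_of_coprime hcop e, fun e => e.mul_left 2⟩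

/-- `first j = first j'` iff `j ≡ j' (mod p₁)` (coordinate 0 of eq. (40) reads `j mod p₁` only). [cite: ChenQuantumLattice2024, eq. (40) p. 36] -/
theorem first_eq_iff (h : π.Admissible) (j j' : ℕ) : π.first j = π.first j' ↔ j ≡ j' [MOD π.p₁] := by
  unfold Params.first
  rw [ZMod.natCast_eq_natCast_iff,
    show π.N = (π.D ^ 2 * π.Q) * π.p₁ by simp only [Params.N, Params.P]; ring,
    show 2 * π.D ^ 2 * π.Q * j = (π.D ^ 2 * π.Q) * (2 * j) by ring,
    show 2 * π.D ^ 2 * π.Q * j' = (π.D ^ 2 * π.Q) * (2 * j') by ring,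
    Nat.ModEq.mul_left_cancel_iff' (Nat.mul_pos (pow_pos h.D_pos 2) (by have := h.Q_ge; omega)).ne']
  have hcop : Nat.gcd π.p₁ 2 = 1 := Nat.coprime_two_right.mpr h.p₁_odd
  exact ⟨fun e => Nat.ModEq.cancel_left_of_coprime hcop e, fun e => e.mul_left 2⟩

/-- `rest j = rest j'` iff `j ≡ j' (mod Q)` (the other coordinates read `j mod Q` only). [cite: ChenQuantumLattice2024, eq. (40) p. 36] -/
theorem rest_eq_iff (h : π.Admissible) (j j' : ℕ) : π.rest j = π.rest j' ↔ j ≡ j' [MOD π.Q] := by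
  unfold Params.rest
  rw [ZMod.natCast_eq_natCast_iff,
    show π.N = (π.D ^ 2 * π.p₁) * π.Q by simp only [Params.N, Params.P]; ring,
    show 2 * π.D ^ 2 * (2 * π.p₁ * π.c) * j = (π.D ^ 2 * π.p₁) * ((4 * π.c) * j) by ring,
    show 2 * π.D ^ 2 * (2 * π.p₁ * π.c) * j' = (π.D ^ 2 * π.p₁) * ((4 * π.c) * j') by ring,
    Nat.ModEq.mul_left_cancel_iff' (Nat.mul_pos (pow_pos h.D_pos 2) h.p₁_pos).ne']
  have h4 : Nat.Coprime π.Q 4 := by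
    have : Nat.Coprime π.Q 2 := Nat.coprime_two_right.mpr h.Q_odd
    simpa using this.mul_right this
  have hcop : Nat.gcd π.Q (4 * π.c) = 1 := h4.mul_right h.c_coprime.symm
  exact ⟨fun e => Nat.ModEq.cancel_left_of_coprime hcop e, fun e => e.mul_left _⟩

/-- The displayed state: `claimed j = claimed j'` iff `j ≡ j' (mod P)`. [cite: ChenQuantumLattice2024, §3.5.9 p. 37] -/
theorem claimed_eq_iff (h : π.Admissible) (j j' : ℕ) : π.claimed j = π.claimed j' ↔ j ≡ j' [MOD π.P] := by
  unfold Params.claimed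
  rw [Prod.mk.injEq, π.claimed_fst_eq_iff h, π.rest_eq_iff h]
  constructor
  · exact fun e => e.1
  · intro e
    refine ⟨e, ?_⟩
    exact Nat.ModEq.of_mul_left π.p₁ (by simpa [Params.P, mul_comm] using e)

/-- The domain-extended state: `extended j h = extended j' h'` iff `j ≡ j' (mod P)` and `h = h'`
(for lift indices `h, h' < Q`). [cite: ChenQuantumLattice2024, Lemma 2.17 p. 14 and §3.5.9 p. 37] -/
theorem extended_eq_iff (h : π.Admissible) (j j' a a' : ℕ) (ha : a < π.Q) (ha' : a' < π.Q) :
    π.extended j a = π.extended j' a' ↔ j ≡ j' [MOD π.P] ∧ a = a' := by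
  haveI : NeZero π.N := ⟨(π.N_pos h).ne'⟩
  unfold Params.extended
  rw [Prod.mk.injEq, π.rest_eq_iff h, ZMod.natCast_eq_natCast_iff]
  have hN := π.N_pos h
  have hlt : ∀ (b : ZMod π.N) (t : ℕ), t < π.Q → b.val + t * π.N < π.N * π.Q := by
    intro b t ht
    have h1 := b.val_lt
    have h2 : t + 1 ≤ π.Q := ht
    calc b.val + t * π.N < π.N + t * π.N := by omega
      _ = (t + 1) * π.N := by ring
      _ ≤ π.Q * π.N := Nat.mul_le_mul_right _ h2
      _ = π.N * π.Q := by ring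
  rw [Nat.ModEq, Nat.mod_eq_of_lt (hlt _ _ ha), Nat.mod_eq_of_lt (hlt _ _ ha')]
  constructor
  · rintro ⟨e1, e2⟩
    -- decode `val + a·N = val' + a'·N` with both `val`s `< N`
    have hv := (π.first j).val_lt
    have hv' := (π.first j').val_lt
    have haa : a = a' := by
      have := Nat.div_add_mod ((π.first j).val + a * π.N) π.N
      have h1 : ((π.first j).val + a * π.N) / π.N = a := by
        rw [Nat.add_mul_div_right _ _ hN, Nat.div_eq_of_lt hv]; simp
      have h2 : ((π.first j').val + a' * π.N) / π.N = a' := by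
        rw [Nat.add_mul_div_right _ _ hN, Nat.div_eq_of_lt hv']; simp
      rw [← h1, ← h2, e1]
    subst haa
    have hvv : (π.first j).val = (π.first j').val := by omega
    have hf : π.first j = π.first j' := ZMod.val_injective _ hvv
    rw [π.first_eq_iff h] at hf
    exact ⟨(Nat.modEq_and_modEq_iff_modEq_mul h.coprime).mp ⟨hf, e2⟩, rfl⟩
  · rintro ⟨e, rfl⟩
    obtain ⟨e1, e2⟩ := (Nat.modEq_and_modEq_iff_modEq_mul h.coprime).mpr e
    rw [← π.first_eq_iff h] at e1
    exact ⟨by rw [e1], e2⟩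

/-- `|claimedSupport| = P`: the displayed |φ8.g⟩ has exactly `p₁p₂⋯p_κ` basis vectors (the author's count, note p. 37). [cite: ChenQuantumLattice2024, §3.5.9 p. 37] -/
theorem card_claimedSupport (h : π.Admissible) : π.claimedSupport.card = π.P := by
  have hP := π.P_pos h
  have hle : π.P ≤ π.N * π.Q := by
    have : 1 ≤ π.D ^ 2 * π.Q := Nat.mul_pos (pow_pos h.D_pos 2) (by have := h.Q_ge; omega)
    calc π.P = 1 * π.P := (one_mul _).symm
      _ ≤ (π.D ^ 2 * π.Q) * π.P := Nat.mul_le_mul_right _ this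
      _ = π.N * π.Q := by simp only [Params.N]; ring
  have himg : π.claimedSupport = (Finset.range π.P).image π.claimed := by
    unfold Params.claimedSupport
    ext x; simp only [Finset.mem_image, Finset.mem_range]
    constructor
    · rintro ⟨j, -, rfl⟩
      exact ⟨j % π.P, Nat.mod_lt _ hP, ((π.claimed_eq_iff h _ _).mpr (Nat.mod_modEq _ _))⟩
    · rintro ⟨j, hj, rfl⟩
      exact ⟨j, lt_of_lt_of_le hj hle, rfl⟩
  rw [himg, Finset.card_image_of_injOn, Finset.card_range]
  intro j hj j' hj' e
  simp only [Finset.coe_range, Set.mem_Iio] at hj hj'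
  have := (π.claimed_eq_iff h _ _).mp e
  exact ((Nat.ModEq.eq_of_lt_of_lt this hj hj'))

/-- `|extendedSupport| = P·Q`: `DomainExt(|φ8.f⟩)` has `p₁p₂⋯p_κ · p₂⋯p_κ` basis vectors (the author's count, note p. 37). [cite: ChenQuantumLattice2024, §3.5.9 p. 37] -/
theorem card_extendedSupport (h : π.Admissible) : π.extendedSupport.card = π.P * π.Q := by
  have hP := π.P_pos h
  have hle : π.P ≤ π.N := by
    have : 1 ≤ π.D ^ 2 := pow_pos h.D_pos 2
    calc π.P = 1 * π.P := (one_mul _).symm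
      _ ≤ π.D ^ 2 * π.P := Nat.mul_le_mul_right _ this
  have himg : π.extendedSupport =
      ((Finset.range π.P) ×ˢ (Finset.range π.Q)).image fun jh => π.extended jh.1 jh.2 := by
    unfold Params.extendedSupport
    ext x; simp only [Finset.mem_image, Finset.mem_product, Finset.mem_range]
    constructor
    · rintro ⟨⟨j, a⟩, ⟨-, ha⟩, rfl⟩
      refine ⟨⟨j % π.P, a⟩, ⟨Nat.mod_lt _ hP, ha⟩, ?_⟩
      exact (π.extended_eq_iff h _ _ _ _ ha ha).mpr ⟨Nat.mod_modEq _ _, rfl⟩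
    · rintro ⟨⟨j, a⟩, ⟨hj, ha⟩, rfl⟩
      exact ⟨⟨j, a⟩, ⟨lt_of_lt_of_le hj hle, ha⟩, rfl⟩
  rw [himg, Finset.card_image_of_injOn, Finset.card_product, Finset.card_range, Finset.card_range]
  rintro ⟨j, a⟩ hj ⟨j', a'⟩ hj' e
  simp only [Finset.coe_product, Finset.coe_range, Set.mem_prod, Set.mem_Iio] at hj hj'
  obtain ⟨e1, e2⟩ := (π.extended_eq_iff h _ _ _ _ hj.2 hj'.2).mp e
  exact Prod.ext (Nat.ModEq.eq_of_lt_of_lt e1 hj.1 hj'.1) e2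

/-- **Verdict** (Chen 2024, §3.5.9, note of April 18): for every admissible parameter choice the
displayed |φ8.g⟩ and the output of the domain-extension trick on |φ8.f⟩ have different supports
(`P` versus `P·Q` basis vectors, `Q ≥ 3`); the displayed equation is false. [cite: ChenQuantumLattice2024, §3.5.9 p. 37] -/
theorem claimedSupport_ne_extendedSupport (h : π.Admissible) :
    π.claimedSupport ≠ π.extendedSupport := by
  intro e
  have := congrArg Finset.card e
  rw [π.card_claimedSupport h, π.card_extendedSupport h] at this
  have hP := π.P_pos h
  have hQ := h.Q_ge
  nlinarith

end Params

/-- The concrete instance (3,5) is admissible (kernel-decided). [folklore] -/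
theorem inst35_admissible : inst35.Admissible :=
  ⟨by decide, by decide, by decide, by decide, by decide, by decide, by decide⟩

/-- The concrete instance (5,3) is admissible (kernel-decided). [folklore] -/
theorem inst53_admissible : inst53.Admissible :=
  ⟨by decide, by decide, by decide, by decide, by decide, by decide, by decide⟩

end Literature.Computability.Cryptography.Chen2024.StepNine
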